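import Literature.Algebra.EuclideanLattices.RegevBranchState
import HarnessLib

/-!
# Regev 2009, Lemmas 3.12/3.14: the long part of a branch of the Gaussian register is negligible

Topic `Algebra/EuclideanLattices` (family `pqc`), sequel of `RegevBranchState.lean`. In the machine
form of the quantum part of Regev's iterative step the register `x` is erased with the help of the
`CVP_{L*}` oracle (Lemma 3.14, proof: "Using the CVP oracle, we can recover `x` from `x mod P(L*)`.
This allows us to uncompute the first register"), which is exact only on the points `x` whose lattice
part `x − y` is short (`‖x − y‖ < √n`, after "By Lemma 2.5, this is exponentially close to
`Σ_{‖x‖<√n} ρ(x)|x⟩`"). What the analysis needs is therefore, branch by branch, a bound on the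
**long part of the branch amplitudes**

  `τ_y(s) = Σ_{x ∈ Box, x − y ∈ x_s + RΛ, ‖x − y‖ ≥ √n} ρ(x)`

relative to the branch vector `ψ_y` itself:

* `Regev2009.tailBranchAmp`, `abs_sum_sub_branchAmp_le` (an amplitude collected over any set of box
  points of the coset containing the short ones differs from `ψ_y(s)` by at most `τ_y(s)`);
* `gaussianFunction_le_exp_mul_of_norm_sub_le` — `ρ(x) ≤ e^{2πBY} ρ(x − y)` for `‖x − y‖ ≤ B`, `‖y‖ ≤ Y`;
* `tailBranchAmp_le` — `τ_y(s) ≤ e^{2πBY} · (ϑ₂ − ϑ₁)(s)` (`tailAmp`: the mass of the long points of the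
  coset, Claim 3.13), by the injection `x ↦ x − y` into the coset;
* **`Regev2009.sum_tailBranchAmp_sq_le`** — `Σ_s τ_y(s)² ≤ e^{4πBY} 4⁻ⁿ Σ_s ϑ₂(s)²` (Claim 3.13 in
  coordinates, `claim_3_13_coords`);
* **`Regev2009.sq_mul_sum_periodicAmp_sq_le`** — `κ² Σ_s ϑ₂(s)² ≤ Σ_s ψ_y(s)²` with
  `κ = (1 − δ)(1 − b₁ⁿ)(1 − 4⁻ⁿ)` under the hypotheses of `RegevBranchState` (from
  `⟨ϑ₂, ψ_y⟩ ≥ κ‖ϑ₂‖²` and Cauchy–Schwarz), so that the long part is `e^{2πBY} 2⁻ⁿ/κ · ‖ψ_y‖`.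

Everything here is proved; definitions have bodies; no named fact is introduced.

## References

* O. Regev, *On lattices, learning with errors, random linear codes, and cryptography*, J. ACM 56
  (2009), art. 34; arXiv:2401.03703, Lemma 3.12 (proof), Claim 3.13, Lemma 3.14 (proof) [Regev2009].
* W. Banaszczyk, *New bounds in some transference theorems in the geometry of numbers*, Math. Ann. 296 (1993), Lemma 1.5 [Banaszczyk1993].
-/

noncomputable section

open Module Metric Complex Finset
open scoped Real InnerProductSpace ENNReal

namespace Literature.Algebra.EuclideanLattices

namespace Regev2009

open Literature.Computability.QuantumComplexity Literature.Computability.QuantumComplexity.QState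

variable {V : Type*} [NormedAddCommGroup V] [InnerProductSpace ℝ V]
variable {ι : Type*} [Fintype ι]
variable (Λ : Submodule ℤ V) (e : Basis ι ℤ Λ) (R : ℕ)

/-! ### The long part of a branch amplitude -/

open Classical in
/-- **The long part of the branch amplitude**: `τ_y(s) = Σ_{x ∈ Box, x − y ∈ x_s + RΛ, ‖x − y‖ ≥ √n} ρ(x)`.
[cite: Regev2009, Lemma 3.14 (proof: the truncation to `‖x‖ < √n` before the uncomputation)] -/
def tailBranchAmp (Box : Finset V) (y : V) (s : ι → ZMod R) : ℝ :=
  ∑ x ∈ Box.filter (fun x => (∃ z : Λ, x - y = reprPt Λ e R s + (R : ℝ) • (z : V)) ∧ Real.sqrt (finrank ℝ V) ≤ ‖x - y‖),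
    gaussianFunction 1 x

/-- The long part is nonnegative. [folklore] -/
theorem tailBranchAmp_nonneg (Box : Finset V) (y : V) (s : ι → ZMod R) : 0 ≤ tailBranchAmp Λ e R Box y s :=
  sum_nonneg fun _ _ => (gaussianFunction_pos _ _).le

open Classical in
/-- **An amplitude collected over a set `G` of box points of the coset with `short ⊆ G` differs from
`ψ_y(s)` by at most `τ_y(s)`** (`ψ_y(s) − Σ_G = Σ_{coset box points ∉ G} ≤ Σ_{long}`).
[cite: Regev2009, Lemma 3.14 (proof)] -/
theorem abs_sum_sub_branchAmp_le {Box G : Finset V} {y : V} {s : ι → ZMod R}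
    (hG : G ⊆ Box.filter (fun x => ∃ z : Λ, x - y = reprPt Λ e R s + (R : ℝ) • (z : V)))
    (hshort : ∀ x ∈ Box, (∃ z : Λ, x - y = reprPt Λ e R s + (R : ℝ) • (z : V)) → ‖x - y‖ < Real.sqrt (finrank ℝ V) → x ∈ G) :
    |∑ x ∈ G, gaussianFunction 1 x - branchAmp Λ e R Box y s| ≤ tailBranchAmp Λ e R Box y s := by
  set F := Box.filter (fun x => ∃ z : Λ, x - y = reprPt Λ e R s + (R : ℝ) • (z : V)) with hF
  have hsplit : branchAmp Λ e R Box y s = ∑ x ∈ G, gaussianFunction 1 x + ∑ x ∈ F \ G, gaussianFunction 1 x := by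
    unfold branchAmp
    rw [← hF, ← sum_sdiff hG, add_comm]
  have hrest : ∑ x ∈ F \ G, gaussianFunction 1 x ≤ tailBranchAmp Λ e R Box y s := by
    unfold tailBranchAmp
    refine sum_le_sum_of_subset_of_nonneg (fun x hx => ?_) (fun _ _ _ => (gaussianFunction_pos _ _).le)
    rw [mem_sdiff, hF, mem_filter] at hx
    rw [mem_filter]
    refine ⟨hx.1.1, hx.1.2, le_of_not_gt fun hlt => hx.2 (hshort x hx.1.1 hx.1.2 hlt)⟩
  have hnn : 0 ≤ ∑ x ∈ F \ G, gaussianFunction 1 x := sum_nonneg fun _ _ => (gaussianFunction_pos _ _).le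
  rw [hsplit, abs_le]
  constructor <;> linarith

/-! ### `ρ(x) ≤ e^{2πBY} ρ(x − y)` and `τ_y(s) ≤ e^{2πBY} (ϑ₂ − ϑ₁)(s)` -/

/-- **`ρ(x) ≤ e^{2πBY} ρ(x − y)`** for `‖x − y‖ ≤ B`, `‖y‖ ≤ Y`
(`‖x‖² ≥ ‖x − y‖² − 2‖x − y‖‖y‖`). [cite: Regev2009, Lemma 3.12 (proof, Claim 2.? on perturbed Gaussians)] -/
theorem gaussianFunction_le_exp_mul_of_norm_sub_le {x y : V} {B Y : ℝ} (hxy : ‖x - y‖ ≤ B) (hy : ‖y‖ ≤ Y) :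
    gaussianFunction 1 x ≤ Real.exp (2 * π * B * Y) * gaussianFunction 1 (x - y) := by
  unfold gaussianFunction
  simp only [one_pow, div_one]
  rw [← Real.exp_add]
  refine Real.exp_le_exp.2 ?_
  have h1 : ‖x - y‖ ^ 2 ≤ ‖x‖ ^ 2 + 2 * (‖x - y‖ * ‖y‖) := by
    have hx : x = (x - y) + y := (sub_add_cancel x y).symm
    have hsq : ‖x‖ ^ 2 = ‖x - y‖ ^ 2 + 2 * ⟪x - y, y⟫_ℝ + ‖y‖ ^ 2 := by
      conv_lhs => rw [hx]
      exact norm_add_sq_real _ _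
    have hinner : -(‖x - y‖ * ‖y‖) ≤ ⟪x - y, y⟫_ℝ := (abs_le.1 (abs_real_inner_le_norm (x - y) y)).1
    nlinarith [sq_nonneg ‖y‖]
  have h2 : ‖x - y‖ * ‖y‖ ≤ B * Y := mul_le_mul hxy hy (norm_nonneg _) ((norm_nonneg _).trans hxy)
  nlinarith [Real.pi_pos]

open Classical in
/-- **The finite long sum sits inside the coset tail**: `Σ_{x ∈ TF} ρ(x − y) ≤ (ϑ₂ − ϑ₁)(s)` where `TF`
is the set of long box points of the coset (the translation `x ↦ x − y − x_s` injects `TF` into the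
long points of `RΛ − (−x_s)`). [cite: Regev2009, Claim 3.13] -/
theorem sum_longFibre_le_tailAmp [FiniteDimensional ℝ V] [DiscreteTopology Λ] [NeZero R] (Box : Finset V) (y : V)
    (s : ι → ZMod R) :
    ∑ x ∈ Box.filter (fun x => (∃ z : Λ, x - y = reprPt Λ e R s + (R : ℝ) • (z : V)) ∧ Real.sqrt (finrank ℝ V) ≤ ‖x - y‖),
        gaussianFunction 1 (x - y) ≤ tailAmp Λ e R s := by
  classical
  set TF := Box.filter (fun x => (∃ z : Λ, x - y = reprPt Λ e R s + (R : ℝ) • (z : V)) ∧ Real.sqrt (finrank ℝ V) ≤ ‖x - y‖)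
    with hTF
  -- translate into the coset `RΛ` (centre `-x_s`)
  set tr : V → V := fun x => x - y - reprPt Λ e R s with htr
  have hinj : Set.InjOn tr TF := fun x _ x' _ h => by
    simp only [htr] at h
    exact sub_left_injective (sub_left_injective h)
  have hsub : ((TF.image tr : Finset V) : Set V) ⊆
      (scaledLattice Λ R : Set V) \ ball (-reprPt Λ e R s) (Real.sqrt (finrank ℝ V)) := by
    intro a ha
    rw [Finset.mem_coe, mem_image] at ha
    obtain ⟨x, hx, rfl⟩ := ha
    rw [hTF, mem_filter] at hx
    obtain ⟨-, ⟨z, hz⟩, hlong⟩ := hx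
    refine ⟨?_, ?_⟩
    · show x - y - reprPt Λ e R s ∈ (scaledLattice Λ R : Set V)
      rw [hz, add_sub_cancel_left]
      exact smul_coe_mem_scaledLattice Λ R z
    · rw [Metric.mem_ball, dist_eq_norm, sub_neg_eq_add, htr]
      simp only [sub_add_cancel, not_lt]
      exact hlong
  -- the finite sum is the Gaussian mass of the finite image
  have hmass : gaussianMass 1 (-reprPt Λ e R s) ((TF.image tr : Finset V) : Set V) =
      ∑ a ∈ TF.image tr, ENNReal.ofReal (gaussianFunction 1 (a - -reprPt Λ e R s)) := by
    unfold gaussianMass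
    rw [tsum_subtype ((TF.image tr : Finset V) : Set V) (fun a => ENNReal.ofReal (gaussianFunction 1 (a - -reprPt Λ e R s))),
      tsum_eq_sum (s := TF.image tr) (fun x hx => Set.indicator_of_notMem (fun h => hx (Finset.mem_coe.1 h)) _)]
    exact Finset.sum_congr rfl fun x hx => Set.indicator_of_mem (Finset.mem_coe.2 hx) _
  have hfin : (gaussianMass 1 (-reprPt Λ e R s) ((TF.image tr : Finset V) : Set V)).toReal =
      ∑ x ∈ TF, gaussianFunction 1 (x - y) := by
    rw [hmass, ENNReal.toReal_sum (fun _ _ => ENNReal.ofReal_ne_top), sum_image hinj]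
    refine sum_congr rfl fun x _ => ?_
    rw [ENNReal.toReal_ofReal (gaussianFunction_pos _ _).le, htr]
    simp only [sub_neg_eq_add, sub_add_cancel]
  rw [← hfin, tailAmp]
  exact ENNReal.toReal_mono (ne_top_of_le_ne_top (gaussianMass_lattice_ne_top (scaledLattice Λ R) one_ne_zero _)
    (gaussianMass_mono _ _ Set.sdiff_subset)) (gaussianMass_mono _ _ hsub)

/-- **`τ_y(s) ≤ e^{2πBY} (ϑ₂ − ϑ₁)(s)`** when every box point is within `B` of `y` and `‖y‖ ≤ Y`.
[cite: Regev2009, Lemma 3.14 (proof), Claim 3.13] -/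
theorem tailBranchAmp_le [FiniteDimensional ℝ V] [DiscreteTopology Λ] [NeZero R] {Box : Finset V} {y : V} {B Y : ℝ}
    (hB : ∀ x ∈ Box, ‖x - y‖ ≤ B) (hy : ‖y‖ ≤ Y) (s : ι → ZMod R) :
    tailBranchAmp Λ e R Box y s ≤ Real.exp (2 * π * B * Y) * tailAmp Λ e R s := by
  classical
  unfold tailBranchAmp
  calc ∑ x ∈ Box.filter (fun x => (∃ z : Λ, x - y = reprPt Λ e R s + (R : ℝ) • (z : V)) ∧ Real.sqrt (finrank ℝ V) ≤ ‖x - y‖),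
        gaussianFunction 1 x
      ≤ ∑ x ∈ Box.filter (fun x => (∃ z : Λ, x - y = reprPt Λ e R s + (R : ℝ) • (z : V)) ∧ Real.sqrt (finrank ℝ V) ≤ ‖x - y‖),
        Real.exp (2 * π * B * Y) * gaussianFunction 1 (x - y) :=
        sum_le_sum fun x hx => gaussianFunction_le_exp_mul_of_norm_sub_le (hB x (mem_filter.1 hx).1) hy
    _ = Real.exp (2 * π * B * Y) * ∑ x ∈ Box.filter (fun x => (∃ z : Λ, x - y = reprPt Λ e R s + (R : ℝ) • (z : V)) ∧
          Real.sqrt (finrank ℝ V) ≤ ‖x - y‖), gaussianFunction 1 (x - y) := by rw [mul_sum]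
    _ ≤ Real.exp (2 * π * B * Y) * tailAmp Λ e R s :=
        mul_le_mul_of_nonneg_left (sum_longFibre_le_tailAmp Λ e R Box y s) (Real.exp_pos _).le

/-! ### The two relative bounds -/

/-- **`Σ_s τ_y(s)² ≤ e^{4πBY} 4⁻ⁿ Σ_s ϑ₂(s)²`** (Claim 3.13 in coordinates for the long parts).
[cite: Regev2009, Claim 3.13, Lemma 3.14 (proof)] -/
theorem sum_tailBranchAmp_sq_le [FiniteDimensional ℝ V] [DiscreteTopology Λ] [IsZLattice ℝ Λ] [DecidableEq ι] [NeZero R]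
    {Box : Finset V} {y : V} {B Y : ℝ} (hB : ∀ x ∈ Box, ‖x - y‖ ≤ B) (hy : ‖y‖ ≤ Y) :
    ∑ s : ι → ZMod R, tailBranchAmp Λ e R Box y s ^ 2 ≤
      Real.exp (4 * π * B * Y) * (4⁻¹ : ℝ) ^ finrank ℝ V * ∑ s : ι → ZMod R, periodicAmp Λ e R s ^ 2 := by
  have h1 : ∑ s : ι → ZMod R, tailBranchAmp Λ e R Box y s ^ 2 ≤
      ∑ s : ι → ZMod R, (Real.exp (2 * π * B * Y) * tailAmp Λ e R s) ^ 2 :=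
    sum_le_sum fun s _ => pow_le_pow_left₀ (tailBranchAmp_nonneg Λ e R Box y s) (tailBranchAmp_le Λ e R hB hy s) 2
  have h2 := claim_3_13_coords Λ e R
  have hexp : Real.exp (2 * π * B * Y) ^ 2 = Real.exp (4 * π * B * Y) := by rw [sq, ← Real.exp_add]; congr 1; ring
  have h4 : (4⁻¹ : ℝ) ^ finrank ℝ V = (2⁻¹ : ℝ) ^ (2 * finrank ℝ V) := by rw [pow_mul]; norm_num
  calc ∑ s : ι → ZMod R, tailBranchAmp Λ e R Box y s ^ 2
      ≤ ∑ s : ι → ZMod R, (Real.exp (2 * π * B * Y) * tailAmp Λ e R s) ^ 2 := h1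
    _ = Real.exp (4 * π * B * Y) * ∑ s : ι → ZMod R, tailAmp Λ e R s ^ 2 := by
        rw [mul_sum]; refine sum_congr rfl fun s _ => ?_; rw [mul_pow, hexp]
    _ ≤ Real.exp (4 * π * B * Y) * ((2⁻¹ : ℝ) ^ (2 * finrank ℝ V) * ∑ s : ι → ZMod R, periodicAmp Λ e R s ^ 2) :=
        mul_le_mul_of_nonneg_left h2 (Real.exp_pos _).le
    _ = _ := by rw [h4]; ring

/-- **`κ² Σ_s ϑ₂(s)² ≤ Σ_s ψ_y(s)²`**, `κ = (1 − δ)(1 − b₁ⁿ)(1 − 4⁻ⁿ)`: the branch vector is not much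
shorter than `ϑ₂` (from `⟨ϑ₂, ψ_y⟩ ≥ κ ‖ϑ₂‖²`, (A) and (C) of `RegevBranchState`, and Cauchy–Schwarz).
[cite: Regev2009, Lemma 3.12 (proof)] -/
theorem sq_mul_sum_periodicAmp_sq_le [FiniteDimensional ℝ V] [MeasurableSpace V] [BorelSpace V]
    [DiscreteTopology Λ] [IsZLattice ℝ Λ] [DecidableEq ι] [NeZero R] {Box : Finset V} {y : V} {Y : ℝ}
    (hsvΛ : ∀ z ∈ scaledLattice Λ R, ‖z‖ < 2 * Real.sqrt (finrank ℝ V) → z = 0)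
    (hBox : BoxCoversShort Λ Box y) (hy : ‖y‖ ≤ Y) (hδ : π * (2 * Real.sqrt (finrank ℝ V) * Y + Y ^ 2) ≤ 1) :
    ((1 - π * (2 * Real.sqrt (finrank ℝ V) * Y + Y ^ 2)) * (1 - banaConst ^ finrank ℝ V) * (1 - (4⁻¹ : ℝ) ^ finrank ℝ V)) ^ 2 *
        ∑ s : ι → ZMod R, periodicAmp Λ e R s ^ 2 ≤
      ∑ s : ι → ZMod R, branchAmp Λ e R Box y s ^ 2 := by
  set n := finrank ℝ V with hn
  set δ : ℝ := π * (2 * Real.sqrt n * Y + Y ^ 2) with hδdef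
  set b : ℝ := banaConst ^ n with hbdef
  set c : ℝ := (4⁻¹ : ℝ) ^ n with hcdef
  set T2 : ℝ := ∑ s : ι → ZMod R, periodicAmp Λ e R s ^ 2 with hT2
  set P2 : ℝ := ∑ s : ι → ZMod R, branchAmp Λ e R Box y s ^ 2 with hP2
  have hb0 : 0 ≤ b := pow_nonneg banaConst_nonneg _
  have hb1 : b ≤ 1 := pow_le_one₀ banaConst_nonneg (banaConst_le.trans (by norm_num))
  have hc1 : c ≤ 1 := pow_le_one₀ (by norm_num) (by norm_num)
  have hκ0 : 0 ≤ (1 - δ) * (1 - b) * (1 - c) := mul_nonneg (mul_nonneg (by linarith) (by linarith)) (by linarith)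
  set κ : ℝ := (1 - δ) * (1 - b) * (1 - c) with hκdef
  -- `κ T2 ≤ ⟨ϑ₂, ψ⟩`
  have hA := sum_periodicAmp_mul_branchAmp_ge Λ e R hBox hy hδ
  have hC := gaussianMass_couplingLattice_toReal_le Λ R hsvΛ
  rw [← sum_periodicAmp_sq_eq Λ e R] at hC
  have hinner : κ * T2 ≤ ∑ s, periodicAmp Λ e R s * branchAmp Λ e R Box y s := by
    have h1 : 0 ≤ (1 - δ) * (1 - b) := mul_nonneg (by linarith) (by linarith)
    calc κ * T2 = (1 - δ) * (1 - b) * ((1 - c) * T2) := by rw [hκdef]; ring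
      _ ≤ (1 - δ) * (1 - b) * ∑' x : Λ, gaussianFunction (Real.sqrt 2)⁻¹ (x : V) := mul_le_mul_of_nonneg_left hC h1
      _ ≤ _ := hA
  -- Cauchy–Schwarz: `⟨ϑ₂, ψ⟩² ≤ T2 · P2`
  have hCS : (∑ s, periodicAmp Λ e R s * branchAmp Λ e R Box y s) ^ 2 ≤ T2 * P2 :=
    Finset.sum_mul_sq_le_sq_mul_sq univ _ _
  have hT2nn : 0 ≤ T2 := sum_nonneg fun _ _ => sq_nonneg _
  have hsq : (κ * T2) ^ 2 ≤ T2 * P2 :=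
    (pow_le_pow_left₀ (mul_nonneg hκ0 hT2nn) hinner 2).trans hCS
  -- cancel one factor `T2`
  by_cases hT : T2 = 0
  · rw [hT, mul_zero]; exact sum_nonneg fun _ _ => sq_nonneg _
  · have hTpos : 0 < T2 := lt_of_le_of_ne hT2nn (Ne.symm hT)
    have : κ ^ 2 * T2 * T2 ≤ P2 * T2 := by nlinarith
    exact le_of_mul_le_mul_right this hTpos

end Regev2009

end Literature.Algebra.EuclideanLattices
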